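import Summits.HodgeConjecture.CorCM.MultiFieldWeilAnyTwoSimpleThreefoldsAnyCurve
import HarnessLib

/-!
# MULTI-FIELD WEIL ENGINE — TWO SIMPLE CM THREEFOLDS, EACH WITH ITS OWN CM ELLIPTIC CURVE: the Hodge conjecture for every `T₀^a × T₁^b × E₀^c × E₁^d`
# (`k₀ ↪ K₀` only, `k₁ ↪ K₁`), given ONLY Markman's fourfold theorem — two absorbed blocks

Cell `pub-hodgecm2` (COR-CM), seat b30 gen 34 (2026-08-24); count-neutral own lane MULTI-FIELD WEIL ENGINE (stem `MultiFieldWeil*`), sequel of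
`CorCM/MultiFieldWeilCurveAbsorption.lean` and `CorCM/MultiFieldWeilAnyTwoSimpleThreefoldsAnyCurve.lean`.  Theorems only; no definition, no named fact, no `sorry`.
HONEST FRAMING: conditional on the displayed Markman fourfold binder only; `HC_CM` is NOT proved and not asserted.

THE STATEMENT (**`hodgeConjectureFor_biproduct_comp_vec_of_two_simpleThreefolds_two_absorbedCurves_of_markman`**).  `T₀ ⊨ (K₀; Φ₀)`, `T₁ ⊨ (K₁; Φ₁)` SIMPLE CM
threefolds (sextic fields); `E₀ ⊨ (k₀; Ψ₀)`, `E₁ ⊨ (k₁; Ψ₁)` CM elliptic curves with `k₀ ↪ K₀`, `k₀ ↪̸ K₁` and `k₁ ↪ K₁` (then `k₁ ↪̸ K₀`).  Then for every `κ : Fin N → Fin 4`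
the Hodge conjecture holds for `⨁_j ![T₀, T₁, E₀, E₁] (κ j)` — every `T₀^a × T₁^b × E₀^c × E₁^d` — GIVEN ONLY `Markman2025_weilClasses_algebraic_abelianFourfold`.
This is the rest block of «two simple CM threefolds × ANY family of CM elliptic curves» (next file): a sextic CM field receives at most one imaginary quadratic
field, so at most one curve of a family of pairwise non-isogenous curves goes to each threefold, the others being foreign.

PROOF — TWO ABSORBED BLOCKS `{T₀, E₀} ∣ {T₁, E₁}`.  If `T₀ ∼ T₁` the product is isogenous to a product of copies of `T₀, E₀, E₁` (gen 33's roof «any two CM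
curves × any simple CM threefold»).  Otherwise `rank(T₀ T₁ E₀ E₁) = rank(T₀ T₁ E₀) = rank(T₀ T₁)` (CURVE ABSORPTION twice: `E₁` into `T₁`, then `E₀` into `T₀`;
`[K_i : ℚ]/2 = 3` odd) `= 7` (b16's census of pairs of simple threefolds: `K₀`, `K₁` share no imaginary quadratic field, the only one of `K₀` being `≅ k₀ ↪̸ K₁`),
and each block has rank `4` (absorption inside the block); so `7 + 2 = 4 + 4 + 1`, `Hg(T₀^a T₁^b E₀^c E₁^d) = Hg(T₀^a E₀^c) × Hg(T₁^b E₁^d)`, and b16's block gluing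
assembles gen 31's G6 on `{E₀, T₀}` and on `{E₁, T₁}` (ANY CM curve × ANY simple CM threefold, mod Markman).

[cite: MoonenZarhin1999LowDim, Thm. (0.1) (a), §3 (3.1)] [cite: Markman2025SurveySecant, Thm. 1.2] [cite: Gordon1999HodgeAVSurvey, §3 Theorem (proof), 7.4–7.7]
[cite: Shimura1998, §18.1] [cite: MumfordAV1970, §19 Thm. 1 and p. 169]

## References
* [MoonenZarhin1999LowDim] B. Moonen, Yu. Zarhin, Math. Ann. 315 (1999) 711–733.  [Markman2025SurveySecant] E. Markman, arXiv:2509.23403, Thm. 1.2.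
  [Gordon1999HodgeAVSurvey] B. B. Gordon, *A survey of the Hodge conjecture for abelian varieties*, §3, 7.4–7.7.  [Shimura1998] G. Shimura, *Abelian varieties with
  complex multiplication and modular functions*, §18.1.  [MumfordAV1970] D. Mumford, *Abelian Varieties*, §19.
-/

noncomputable section

open CategoryTheory CategoryTheory.Limits NumberField IntermediateField

namespace Summit.HodgeConjecture.CorCM.MultiFieldWeil

open Literature.AlgebraicGeometry Literature.AlgebraicGeometry.Motives Literature.AlgebraicGeometry.HodgeTheory
open Literature.AlgebraicGeometry.ComplexMultiplication (IsCMTypeRealisation)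
open Literature.AlgebraicTopology.SingularHomology
open Literature.NumberTheory.ComplexMultiplication
open Literature.AlgebraicGeometry.Pohlmann1968 (IsNondegenerate)
open Literature.AlgebraicGeometry.Pohlmann1968.CMAlgebra

open scoped Classical

section TwoAbsorbedBlocks

variable {K₀ K₁ k₀ k₁ : Type} [Field K₀] [NumberField K₀] [IsCMField K₀] [Field K₁] [NumberField K₁] [IsCMField K₁] [Field k₀] [NumberField k₀] [IsCMField k₀]
  [Field k₁] [NumberField k₁] [IsCMField k₁]
  {N : ℕ} {T₀ T₁ E₀ E₁ : AbelianVariety ℂ} {Φ₀ : CMType K₀} {Φ₁ : CMType K₁} {Ψ₀ : CMType k₀} {Ψ₁ : CMType k₁}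
  {ι₀ : 𝓞 K₀ →+* End T₀} {θ₀ : K₀ →+* Module.End ℂ (complexBetti T₀.X 1)}
  {ι₁ : 𝓞 K₁ →+* End T₁} {θ₁ : K₁ →+* Module.End ℂ (complexBetti T₁.X 1)}
  {ιE₀ : 𝓞 k₀ →+* End E₀} {θE₀ : k₀ →+* Module.End ℂ (complexBetti E₀.X 1)}
  {ιE₁ : 𝓞 k₁ →+* End E₁} {θE₁ : k₁ →+* Module.End ℂ (complexBetti E₁.X 1)}

/-- **TWO SIMPLE CM THREEFOLDS, EACH WITH ITS OWN ABSORBED CM ELLIPTIC CURVE — given ONLY Markman's fourfold theorem.**  `T₀ ⊨ (K₀; Φ₀)`, `T₁ ⊨ (K₁; Φ₁)` simple CM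
threefolds, `E₀ ⊨ (k₀; Ψ₀)`, `E₁ ⊨ (k₁; Ψ₁)` CM elliptic curves with `i₀ : k₀ ↪ K₀`, `k₀ ↪̸ K₁`, `i₁ : k₁ ↪ K₁`.  Then for every `κ : Fin N → Fin 4` the Hodge
conjecture holds for `⨁_j ![T₀, T₁, E₀, E₁] (κ j)`.  `T₀ ∼ T₁`: gen 33's roof on `{E₀, E₁, T₀}` up to isogeny.  `T₀ ≁ T₁`: two curve absorptions give
`rank(T₀ T₁ E₀ E₁) = rank(T₀ T₁) = 7` and block ranks `4`, `4`; b16's block gluing over G6 twice. [cite: MoonenZarhin1999LowDim, Thm. (0.1) (a), §3 (3.1)]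
[cite: Markman2025SurveySecant, Thm. 1.2] [cite: Gordon1999HodgeAVSurvey, §3 Theorem (proof), 7.5–7.7] -/
theorem hodgeConjectureFor_biproduct_comp_vec_of_two_simpleThreefolds_two_absorbedCurves_of_markman (hW4 : Markman2025_weilClasses_algebraic_abelianFourfold)
    (h6₀ : Module.finrank ℚ K₀ = 6) (h6₁ : Module.finrank ℚ K₁ = 6) (h2₀ : Module.finrank ℚ k₀ = 2) (h2₁ : Module.finrank ℚ k₁ = 2)
    (hT₀ : IsCMTypeRealisation Φ₀ T₀ ι₀ θ₀) (hT₁ : IsCMTypeRealisation Φ₁ T₁ ι₁ θ₁) (hE₀ : IsCMTypeRealisation Ψ₀ E₀ ιE₀ θE₀)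
    (hE₁ : IsCMTypeRealisation Ψ₁ E₁ ιE₁ θE₁) (hS₀ : T₀.IsSimple) (hS₁ : T₁.IsSimple) (i₀ : k₀ →+* K₀) (h₀₁ : IsEmpty (k₀ →+* K₁)) (i₁ : k₁ →+* K₁)
    (κ : Fin N → Fin 4) :
    HodgeConjectureFor (⨁ fun j => (![T₀, T₁, E₀, E₁] : Fin 4 → AbelianVariety ℂ) (κ j)).dim
      (⨁ fun j => (![T₀, T₁, E₀, E₁] : Fin 4 → AbelianVariety ℂ) (κ j)).X := by
  -- `T₀ ∼ T₁`: a product of copies of `E₀, E₁, T₀` up to isogeny (gen 33's roof: any two CM curves × any simple CM threefold)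
  by_cases hiso : AbelianVariety.IsIsogenous T₀ T₁
  · refine hodgeConjectureFor_of_isIsogenous_biproduct_comp_of_two_cmCurves_simpleThreefold_of_markman hW4 h2₀ h2₁ h6₀ hE₀ hE₁ hT₀ hS₀
      (fun j => (![2, 2, 0, 1] : Fin 4 → Fin 3) (κ j)) (AbelianVariety.IsIsogenous.biproduct fun j => ?_)
    show AbelianVariety.IsIsogenous ((![T₀, T₁, E₀, E₁] : Fin 4 → AbelianVariety ℂ) (κ j))
      ((![E₀, E₁, T₀] : Fin 3 → AbelianVariety ℂ) ((![2, 2, 0, 1] : Fin 4 → Fin 3) (κ j)))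
    generalize κ j = c
    fin_cases c
    · exact AbelianVariety.IsIsogenous.refl T₀
    · exact hiso.symm'
    · exact AbelianVariety.IsIsogenous.refl E₀
    · exact AbelianVariety.IsIsogenous.refl E₁
  have h3₀ : T₀.dim ≤ 3 := by rw [AndreProductForm.dim_eq_of_isCMTypeRealisation hT₀, h6₀]
  have h3₁ : T₁.dim ≤ 3 := by rw [AndreProductForm.dim_eq_of_isCMTypeRealisation hT₁, h6₁]
  -- the family of fields `(K₀, K₁, k₀, k₁)` with its instances (all identifications below are definitional)
  let Kf : Fin 4 → Type := Fin.cons K₀ (Fin.cons K₁ (Fin.cons k₀ (Fin.cons k₁ finZeroElim)))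
  letI instF : ∀ j, Field (Kf j) := Fin.cons ‹Field K₀› (Fin.cons ‹Field K₁› (Fin.cons ‹Field k₀› (Fin.cons ‹Field k₁› finZeroElim)))
  letI instN : ∀ j, NumberField (Kf j) :=
    Fin.cons ‹NumberField K₀› (Fin.cons ‹NumberField K₁› (Fin.cons ‹NumberField k₀› (Fin.cons ‹NumberField k₁› finZeroElim)))
  haveI instC : ∀ j, IsCMField (Kf j) :=
    Fin.cons ‹IsCMField K₀› (Fin.cons ‹IsCMField K₁› (Fin.cons ‹IsCMField k₀› (Fin.cons ‹IsCMField k₁› finZeroElim)))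
  let Φf : ∀ j : Fin 4, CMType (Kf j) := Fin.cons Φ₀ (Fin.cons Φ₁ (Fin.cons Ψ₀ (Fin.cons Ψ₁ finZeroElim)))
  let ιf : ∀ j : Fin 4, 𝓞 (Kf j) →+* End ((![T₀, T₁, E₀, E₁] : Fin 4 → AbelianVariety ℂ) j) :=
    Fin.cons ι₀ (Fin.cons ι₁ (Fin.cons ιE₀ (Fin.cons ιE₁ finZeroElim)))
  let θf : ∀ j : Fin 4, Kf j →+* Module.End ℂ (complexBetti ((![T₀, T₁, E₀, E₁] : Fin 4 → AbelianVariety ℂ) j).X 1) :=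
    Fin.cons θ₀ (Fin.cons θ₁ (Fin.cons θE₀ (Fin.cons θE₁ finZeroElim)))
  have hA : ∀ j, IsCMTypeRealisation (Φf j) ((![T₀, T₁, E₀, E₁] : Fin 4 → AbelianVariety ℂ) j) (ιf j) (θf j) :=
    Fin.cons hT₀ (Fin.cons hT₁ (Fin.cons hE₀ (Fin.cons hE₁ finZeroElim)))
  have hnd₀ : IsNondegenerate (Φf 0) := isNondegenerate_of_isSimple_of_dim_le_three_slot hA (b := 0) hS₀ h3₀
  have hnd₁ : IsNondegenerate (Φf 1) := isNondegenerate_of_isSimple_of_dim_le_three_slot hA (b := 1) hS₁ h3₁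
  have h2f₂ : Module.finrank ℚ (Kf 2) = 2 := h2₀
  have h2f₃ : Module.finrank ℚ (Kf 3) = 2 := h2₁
  have hodd₀ : ¬ 2 ∣ Module.finrank ℚ (Kf 0) / 2 := by
    rw [show Module.finrank ℚ (Kf 0) = 6 from h6₀]
    decide
  have hodd₁ : ¬ 2 ∣ Module.finrank ℚ (Kf 1) / 2 := by
    rw [show Module.finrank ℚ (Kf 1) = 6 from h6₁]
    decide
  -- (a) the pair `(T₀, T₁)` is nondegenerate: rank `7` (re-indexed along `Fin 2 → Fin 4`)
  let ε₂ : Fin 2 → Fin 4 := fun j => Fin.castSucc (Fin.castSucc j)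
  have hpair : cmFamilyRank (fun j : Fin 2 => Φf (ε₂ j)) = 7 := by
    have hI : ∀ j : Fin 2, j = 0 ∨ j = 1 := fun j => by fin_cases j <;> simp
    have hnd := (isNondegenerateFamily_simpleThreefolds_iff (Φ := fun j : Fin 2 => Φf (ε₂ j))
      (A := fun j => (![T₀, T₁, E₀, E₁] : Fin 4 → AbelianVariety ℂ) (ε₂ j)) (ι := fun j => ιf (ε₂ j)) (θ := fun j => θf (ε₂ j))
      (i₀ := (0 : Fin 2)) (i₁ := 1) zero_ne_one hI ?_ (fun j => hA (ε₂ j)) ?_ ?_).2 ?_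
    · rw [isNondegenerateFamily_iff, Fin.sum_univ_two] at hnd
      rw [hnd, show Module.finrank ℚ (Kf (ε₂ 0)) = 6 from h6₀, show Module.finrank ℚ (Kf (ε₂ 1)) = 6 from h6₁]
      decide
    · intro j
      fin_cases j
      · exact h6₀
      · exact h6₁
    · intro j
      fin_cases j
      · exact hS₀
      · exact hS₁
    · intro i j hij
      fin_cases i <;> fin_cases j
      · exact absurd rfl hij
      · exact hiso
      · exact fun h => hiso h.symm'
      · exact absurd rfl hij
    · exact not_exists_quadratic_ringHom_of_isEmpty h2₀ h6₀ i₀ h₀₁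
  -- (b) absorb `E₁` into `T₁` (drop slot `3`), then `E₀` into `T₀` (drop slot `2`): rank of the whole family `= 7`
  have hrank₃ : cmFamilyRank (fun j : Fin 3 => Φf (Fin.castSucc j)) = 7 := by
    rw [← hpair]
    refine (cmFamilyRank_comp_eq_of_quadratic_slot_of_odd (fun j : Fin 3 => Φf (Fin.castSucc j)) (i₀ := 2) h2f₂ Fin.castSucc (fun i hi => ?_) 0 i₀
      hodd₀).symm
    fin_cases i
    · exact ⟨0, rfl⟩
    · exact ⟨1, rfl⟩
    · exact absurd rfl hi
  have hrank : cmFamilyRank Φf = 7 := by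
    rw [← hrank₃]
    refine (cmFamilyRank_comp_eq_of_quadratic_slot_of_odd Φf (i₀ := 3) h2f₃ Fin.castSucc (fun i hi => ?_) 1 i₁ hodd₁).symm
    fin_cases i
    · exact ⟨0, rfl⟩
    · exact ⟨1, rfl⟩
    · exact ⟨2, rfl⟩
    · exact absurd rfl hi
  -- the blocks `{T₁, E₁}` (true) and `{T₀, E₀}` (false)
  let κb : Fin 4 → Bool := fun i => decide (i = 1 ∨ i = 3)
  -- (c) the block `{T₀, E₀}`: rank `4`
  have hX : cmFamilyRank (fun i : {i : Fin 4 // κb i = false} => Φf i.1) = 4 := by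
    have h := cmFamilyRank_comp_eq_of_quadratic_slot_of_odd (fun i : {i : Fin 4 // κb i = false} => Φf i.1) (i₀ := ⟨2, by decide⟩) h2f₂
      (fun _ : Fin 1 => (⟨0, by decide⟩ : {i : Fin 4 // κb i = false})) (fun i hi => ?_) 0 i₀ hodd₀
    · rw [← h]
      have h1 := cmFamilyRank_eq_of_isNondegenerate_of_unique (K := fun _ : Fin 1 => K₀) (fun _ : Fin 1 => Φ₀) hnd₀
      rw [h6₀] at h1
      exact h1
    · obtain ⟨i, hi'⟩ := i
      fin_cases i
      · exact ⟨0, rfl⟩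
      · exact absurd hi' (by decide)
      · exact absurd rfl hi
      · exact absurd hi' (by decide)
  -- (d) the block `{T₁, E₁}`: rank `4`
  have hY : cmFamilyRank (fun i : {i : Fin 4 // κb i = true} => Φf i.1) = 4 := by
    have h := cmFamilyRank_comp_eq_of_quadratic_slot_of_odd (fun i : {i : Fin 4 // κb i = true} => Φf i.1) (i₀ := ⟨3, by decide⟩) h2f₃
      (fun _ : Fin 1 => (⟨1, by decide⟩ : {i : Fin 4 // κb i = true})) (fun i hi => ?_) 0 i₁ hodd₁
    · rw [← h]
      have h1 := cmFamilyRank_eq_of_isNondegenerate_of_unique (K := fun _ : Fin 1 => K₁) (fun _ : Fin 1 => Φ₁) hnd₁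
      rw [h6₁] at h1
      exact h1
    · obtain ⟨i, hi'⟩ := i
      fin_cases i
      · exact absurd hi' (by decide)
      · exact ⟨0, rfl⟩
      · exact absurd hi' (by decide)
      · exact absurd rfl hi
  -- (e) the rank equation over the two blocks: `7 + 2 = 4 + 4 + 1`
  have hadd : cmFamilyRank Φf + Fintype.card Bool = (∑ c : Bool, cmFamilyRank fun i : {i : Fin 4 // κb i = c} => Φf i.1) + 1 := by
    rw [Fintype.card_bool, Fintype.sum_bool, hX, hY, hrank]
  -- (f) glue: each block is gen 31's G6 (any CM curve × any simple CM threefold)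
  cases N with
  | zero =>
    have hfun : (fun j => (![T₀, T₁, E₀, E₁] : Fin 4 → AbelianVariety ℂ) (κ j)) = fun _ : Fin 0 => T₀ := funext fun j => j.elim0
    rw [hfun]
    exact hodgeConjectureFor_biproduct_const_of_dim_le_three hT₀ h3₀ 0
  | succ N =>
    refine hodgeConjectureFor_biproduct_of_cmFamilyRank_fiber_add_card_eq κb (fun c => ?_) hadd hA (fun c J _ _ π => ?_) κ
    · cases c
      · exact ⟨0, by decide⟩
      · exact ⟨1, by decide⟩
    · cases c
      · -- the block `{T₀, E₀}`
        have key : ∀ i : Fin 4, κb i = false →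
            (![T₀, T₁, E₀, E₁] : Fin 4 → AbelianVariety ℂ) i = (![E₀, T₀] : Fin 2 → AbelianVariety ℂ) (if i = 0 then 1 else 0) := by
          intro i hi
          fin_cases i
          · rfl
          · exact absurd hi (by decide)
          · rfl
          · exact absurd hi (by decide)
        have hfun : (fun j => (![T₀, T₁, E₀, E₁] : Fin 4 → AbelianVariety ℂ) (π j).1) =
            fun j => (![E₀, T₀] : Fin 2 → AbelianVariety ℂ) (if (π j).1 = 0 then 1 else 0) := funext fun j => key (π j).1 (π j).2
        rw [hfun]
        exact hodgeConjectureFor_of_isIsogenous_biproduct_comp_of_cmCurve_simpleThreefold_of_markman hW4 h2₀ h6₀ hE₀ hT₀ hS₀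
          (fun j => if (π j).1 = 0 then 1 else 0) (AbelianVariety.IsIsogenous.refl _)
      · -- the block `{T₁, E₁}`
        have key : ∀ i : Fin 4, κb i = true →
            (![T₀, T₁, E₀, E₁] : Fin 4 → AbelianVariety ℂ) i = (![E₁, T₁] : Fin 2 → AbelianVariety ℂ) (if i = 1 then 1 else 0) := by
          intro i hi
          fin_cases i
          · exact absurd hi (by decide)
          · rfl
          · exact absurd hi (by decide)
          · rfl
        have hfun : (fun j => (![T₀, T₁, E₀, E₁] : Fin 4 → AbelianVariety ℂ) (π j).1) =
            fun j => (![E₁, T₁] : Fin 2 → AbelianVariety ℂ) (if (π j).1 = 1 then 1 else 0) := funext fun j => key (π j).1 (π j).2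
        rw [hfun]
        exact hodgeConjectureFor_of_isIsogenous_biproduct_comp_of_cmCurve_simpleThreefold_of_markman hW4 h2₁ h6₁ hE₁ hT₁ hS₁
          (fun j => if (π j).1 = 1 then 1 else 0) (AbelianVariety.IsIsogenous.refl _)

/-- **Dominated form**: everything dominated by some `T₀^a × T₁^b × E₀^c × E₁^d` (two simple CM threefolds, each with its own absorbed CM elliptic curve), given only
Markman's fourfold theorem. [cite: MoonenZarhin1999LowDim, Thm. (0.1) (a)] [cite: Markman2025SurveySecant, Thm. 1.2] [cite: MumfordAV1970, §19 Thm. 1 and p. 169] -/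
theorem hodgeConjectureFor_of_avDominatedBy_comp_vec_of_two_simpleThreefolds_two_absorbedCurves_of_markman (hW4 : Markman2025_weilClasses_algebraic_abelianFourfold)
    (h6₀ : Module.finrank ℚ K₀ = 6) (h6₁ : Module.finrank ℚ K₁ = 6) (h2₀ : Module.finrank ℚ k₀ = 2) (h2₁ : Module.finrank ℚ k₁ = 2)
    (hT₀ : IsCMTypeRealisation Φ₀ T₀ ι₀ θ₀) (hT₁ : IsCMTypeRealisation Φ₁ T₁ ι₁ θ₁) (hE₀ : IsCMTypeRealisation Ψ₀ E₀ ιE₀ θE₀)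
    (hE₁ : IsCMTypeRealisation Ψ₁ E₁ ιE₁ θE₁) (hS₀ : T₀.IsSimple) (hS₁ : T₁.IsSimple) (i₀ : k₀ →+* K₀) (h₀₁ : IsEmpty (k₀ →+* K₁)) (i₁ : k₁ →+* K₁)
    (κ : Fin N → Fin 4) {X : AbelianVariety ℂ}
    (hX : Domination.AVDominatedBy X (⨁ fun j => (![T₀, T₁, E₀, E₁] : Fin 4 → AbelianVariety ℂ) (κ j))) : HodgeConjectureFor X.dim X.X :=
  Domination.hodgeConjectureFor_of_avDominatedBy
    (hodgeConjectureFor_biproduct_comp_vec_of_two_simpleThreefolds_two_absorbedCurves_of_markman hW4 h6₀ h6₁ h2₀ h2₁ hT₀ hT₁ hE₀ hE₁ hS₀ hS₁ i₀ h₀₁ i₁ κ)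
    hX

/-- **Every abelian variety ISOGENOUS TO A PRODUCT OF COPIES of `T₀, T₁, E₀, E₁`** (any finite index type), given only Markman's fourfold theorem.
[cite: MoonenZarhin1999LowDim, Thm. (0.1) (a)] [cite: Markman2025SurveySecant, Thm. 1.2] [cite: MumfordAV1970, §19] -/
theorem hodgeConjectureFor_of_isIsogenous_biproduct_comp_of_two_simpleThreefolds_two_absorbedCurves_of_markman
    (hW4 : Markman2025_weilClasses_algebraic_abelianFourfold) (h6₀ : Module.finrank ℚ K₀ = 6) (h6₁ : Module.finrank ℚ K₁ = 6) (h2₀ : Module.finrank ℚ k₀ = 2)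
    (h2₁ : Module.finrank ℚ k₁ = 2) (hT₀ : IsCMTypeRealisation Φ₀ T₀ ι₀ θ₀) (hT₁ : IsCMTypeRealisation Φ₁ T₁ ι₁ θ₁) (hE₀ : IsCMTypeRealisation Ψ₀ E₀ ιE₀ θE₀)
    (hE₁ : IsCMTypeRealisation Ψ₁ E₁ ιE₁ θE₁) (hS₀ : T₀.IsSimple) (hS₁ : T₁.IsSimple) (i₀ : k₀ →+* K₀) (h₀₁ : IsEmpty (k₀ →+* K₁)) (i₁ : k₁ →+* K₁)
    {J : Type} [Fintype J] (cls : J → Fin 4) {X : AbelianVariety ℂ}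
    (hX : AbelianVariety.IsIsogenous X (⨁ fun j => (![T₀, T₁, E₀, E₁] : Fin 4 → AbelianVariety ℂ) (cls j))) : HodgeConjectureFor X.dim X.X := by
  let ε : Fin (Fintype.card J) ≃ J := (Fintype.equivFin J).symm
  have e : (⨁ fun j => (![T₀, T₁, E₀, E₁] : Fin 4 → AbelianVariety ℂ) (cls j)) ≅ ⨁ fun l => (![T₀, T₁, E₀, E₁] : Fin 4 → AbelianVariety ℂ) (cls (ε l)) :=
    (biproduct.reindex ε fun j => (![T₀, T₁, E₀, E₁] : Fin 4 → AbelianVariety ℂ) (cls j)).symm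
  exact hodgeConjectureFor_of_avDominatedBy_comp_vec_of_two_simpleThreefolds_two_absorbedCurves_of_markman hW4 h6₀ h6₁ h2₀ h2₁ hT₀ hT₁ hE₀ hE₁ hS₀ hS₁ i₀
    h₀₁ i₁ (fun l => cls (ε l)) (Domination.AVDominatedBy.of_isIsogenous hX (Domination.AVDominatedBy.of_iso e (Domination.AVDominatedBy.refl _)))

end TwoAbsorbedBlocks

end Summit.HodgeConjecture.CorCM.MultiFieldWeil

end
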